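import Summits.HodgeConjecture.HodgeConjecture.Theses.NikulinTwinTransport

/-!
# `NikulinSerreCarrier` (stmt-HodgeConjecture-14464) · Negative · ι-invariant carriers are frame-pinned

Negative knowledge for the informal crux `NikulinSerreCarrier` (route NikulinTwinTransport, r3) and
for every idea card proposing a carrier `G` on `X × S` (`S = Y′` or a Fourier–Mukai partner / an
ι-fixed K3 component `S″ ⊂ M_X(v)`) whose MIXED class, read as a correspondence
`T : H²(X,ℝ) → H²(S,ℝ)`, kills the ι-anti-invariant lattice `E := H²(X,ℤ)^{ι* = −1} ≅ E₈(−2)`.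
This is automatic when `(ι × 1)^* G ≅ G` (McKay push–pull carriers `(b×1)_*(g̃×1)^*𝒱`, card
bkr-kernel-lattice-certificate) and when `G = 𝓔|_{X×S″}` for a component `S″ ⊂ Fix(ι^M)` of the
induced involution on a moduli space (card mckay-fixed-locus-universal-instanton; there
`T = −j^* ∘ θ_v ∘ pr` and `j^*` kills `ι^M`-anti-invariant classes): `map_eq_zero_of_comp_eq_of_anti`.

DICTIONARY. `V = H²(X,ℝ)`, `W = H²(S,ℝ)` with cup forms `B`, `B'`; `P ⊂ V`, `P' ⊂ W` the positive
3-planes `⟨ω, Re σ, Im σ⟩` of the two hyperkähler structures; Verbitsky's criterion asks the mixed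
class to be invariant under the diagonal `SU(2)`, i.e. `T` equivariant: `T(P) ⊆ P'` (conformally,
`T ω ≠ 0` as soon as `T` sees `H^{2,0}`) and `T(P^⊥) ⊆ P'^⊥`; `B'` is positive definite on `P'`.
At the Nikulin anchor — and on every fibre of a twistor line whose 3-plane is `⊥ E` — one has
`E ⊂ H^{1,1}(X)`, i.e. `E ⊥ ⟨Re σ, Im σ⟩ = P ∩ ω^⊥` (hypothesis `heP`).

RESULTS.
* `pairing_eq_zero_of_killed` — if `T e = 0` and `e ⊥ P ∩ ω^⊥` then `e ⊥ ω`
  (`x := e − (e.ω/ω.ω) ω ∈ P^⊥`, so `T x = −(e.ω/ω.ω) T ω ∈ P' ∩ P'^⊥ = 0`).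
* `antiInvariant_part_eq_zero` — hence the anti-invariant part of the Kähler class of `X` vanishes:
  an `(ι × 1)`-invariant carrier is hyperholomorphic ONLY for ι-invariant Kähler classes `ω_X`.
  In particular it is NOT hyperholomorphic in the crux's own frame `ω = Ψ(ω′) = g^*h − Σ εⱼ rⱼ`
  (`εⱼ > 0`: anti-invariant part `−Σ εⱼ rⱼ ≠ 0`), and
* `threePlane_perp_of_invariant` — with `ω_X` ι-invariant the whole 3-plane is `⊥ E`, so `E` stays
  of type `(1,1)` on EVERY fibre of the twistor line: the line lies in the Nikulin locus and the
  hypothesis `heP` reproduces itself at every node.  Transport by twistor paths of product structures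
  therefore never hands such a carrier to a twin pair off the Nikulin locus (crux TwinTwistorTransport),
  where alone the target `TwinSimilitudeAlgebraic` is new (Varesco 2023 Thm 2.1 covers the locus).
This is the linear-algebra core of "ι-fixed components are dead for all Mukai vectors" and of the
reason the route COMPLETES `g^*` by `Nⱼ ↦ rⱼ`: a usable carrier must act non-trivially on `E₈(−2)`.

Refuter seat refuter-cruxtri-stmt-HodgeConjecture-14464-r1-1-0 (crux-triage r1, triager 1), 2026-08-15.
-/

namespace Summit.HodgeConjecture.HodgeConjecture.Theorems.NikulinSerreCarrier.Negative

variable {V W : Type*} [AddCommGroup V] [Module ℝ V] [AddCommGroup W] [Module ℝ W]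

/-- An `ι`-invariant correspondence (`T ∘ ι^* = T`) kills every `ι^*`-anti-invariant class.
[folklore] -/
theorem map_eq_zero_of_comp_eq_of_anti (T : V →ₗ[ℝ] W) (s : V →ₗ[ℝ] V) (h : T ∘ₗ s = T)
    {e : V} (he : s e = -e) : T e = 0 := by
  have h1 : T (s e) = T e := by rw [← LinearMap.comp_apply, h]
  rw [he, map_neg] at h1
  have h3 : T e + T e = 0 := by
    calc T e + T e = -T e + T e := by rw [h1]
      _ = 0 := neg_add_cancel (T e)
  have h2 : (2 : ℝ) • T e = 0 := by rwa [two_smul]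
  exact (smul_eq_zero.mp h2).resolve_left two_ne_zero

/-- FRAME PINNING (core).  `T` equivariant for the 3-planes `P`, `P'` (`T(P) ⊆ P'`, `T(P^⊥) ⊆ P'^⊥`,
`B'` anisotropic on `P'`), `ω ∈ P` with `ω.ω ≠ 0` and `T ω ≠ 0`; if `T` kills `e` and `e` is
orthogonal to `P ∩ ω^⊥` (= `⟨Re σ, Im σ⟩`: `e` of type `(1,1)`), then `e ⊥ ω`. [folklore] -/
theorem pairing_eq_zero_of_killed (B : V →ₗ[ℝ] V →ₗ[ℝ] ℝ) (B' : W →ₗ[ℝ] W →ₗ[ℝ] ℝ)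
    (T : V →ₗ[ℝ] W) (P : Submodule ℝ V) (P' : Submodule ℝ W)
    (hTP : ∀ p ∈ P, T p ∈ P')
    (hTperp : ∀ x : V, (∀ p ∈ P, B x p = 0) → ∀ p' ∈ P', B' (T x) p' = 0)
    (hpos : ∀ p' ∈ P', B' p' p' = 0 → p' = 0)
    {ω e : V} (hω : ω ∈ P) (hωω : B ω ω ≠ 0) (hTω : T ω ≠ 0)
    (hTe : T e = 0) (heP : ∀ p ∈ P, B ω p = 0 → B e p = 0) :
    B e ω = 0 := by
  set c : ℝ := B e ω / B ω ω with hc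
  set x : V := e - c • ω with hx
  have hxP : ∀ p ∈ P, B x p = 0 := by
    intro p hp
    set a : ℝ := B ω p / B ω ω with ha
    have hs : B ω (p - a • ω) = 0 := by
      simp only [map_sub, map_smul, smul_eq_mul, ha]
      field_simp
      ring
    have hes : B e (p - a • ω) = 0 := heP _ (P.sub_mem hp (P.smul_mem a hω)) hs
    have hep : B e p = c * B ω p := by
      have h0 : B e p = a * B e ω := by
        simp only [map_sub, map_smul, smul_eq_mul] at hes
        linarith
      rw [h0, ha, hc]
      ring
    simp only [hx, map_sub, map_smul, LinearMap.sub_apply, LinearMap.smul_apply, smul_eq_mul]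
    rw [hep]
    ring
  have h1 : ∀ p' ∈ P', B' (T x) p' = 0 := hTperp x hxP
  have hTx : T x = -(c • T ω) := by
    simp only [hx, map_sub, map_smul, hTe, zero_sub]
  have hTxP' : T x ∈ P' := by
    rw [hTx]
    exact P'.neg_mem (P'.smul_mem c (hTP ω hω))
  have hTx0 : T x = 0 := hpos _ hTxP' (h1 _ hTxP')
  rw [hTx, neg_eq_zero, smul_eq_zero] at hTx0
  rcases hTx0 with h | h
  · rw [hc, div_eq_zero_iff] at h
    rcases h with h | h
    · exact h
    · exact absurd h hωω
  · exact absurd h hTω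

/-- FRAME PINNING (geometric packaging).  `s = ι^*` an isometry of `(V, B)` whose `(−1)`-eigenspace
(`E₈(−2) ⊗ ℝ`) is negative definite; `T` an `s`-invariant correspondence, equivariant for the
3-planes `P`, `P'`; the Kähler class `ω = w + e` (`s w = w`, `s e = −e`) lies in `P`, is
non-isotropic and seen by `T`, and `e ⊥ P ∩ ω^⊥` (the anti-invariant lattice is of type `(1,1)`:
Nikulin locus).  THEN `e = 0`: the Kähler class of `X` is ι-invariant. [folklore] -/
theorem antiInvariant_part_eq_zero (B : V →ₗ[ℝ] V →ₗ[ℝ] ℝ) (B' : W →ₗ[ℝ] W →ₗ[ℝ] ℝ)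
    (T : V →ₗ[ℝ] W) (s : V →ₗ[ℝ] V) (P : Submodule ℝ V) (P' : Submodule ℝ W)
    (hB : ∀ x y : V, B (s x) (s y) = B x y)
    (hneg : ∀ e : V, s e = -e → e ≠ 0 → B e e < 0)
    (hT : T ∘ₗ s = T)
    (hTP : ∀ p ∈ P, T p ∈ P')
    (hTperp : ∀ x : V, (∀ p ∈ P, B x p = 0) → ∀ p' ∈ P', B' (T x) p' = 0)
    (hpos : ∀ p' ∈ P', B' p' p' = 0 → p' = 0)
    {w e : V} (hw : s w = w) (he : s e = -e)
    (hω : w + e ∈ P) (hωω : B (w + e) (w + e) ≠ 0) (hTω : T (w + e) ≠ 0)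
    (heP : ∀ p ∈ P, B (w + e) p = 0 → B e p = 0) :
    e = 0 := by
  have hTe : T e = 0 := map_eq_zero_of_comp_eq_of_anti T s hT he
  have h0 : B e (w + e) = 0 :=
    pairing_eq_zero_of_killed B B' T P P' hTP hTperp hpos hω hωω hTω hTe heP
  have hew : B e w = 0 := by
    have h1 := hB e w
    rw [he, hw, map_neg, LinearMap.neg_apply] at h1
    linarith
  have hee : B e e = 0 := by
    rw [map_add] at h0
    linarith
  by_contra hne
  exact absurd hee (hneg e he hne).ne

/-- Propagation: once the Kähler class `ω` is `⊥ e` and `e ⊥ ⟨Re σ, Im σ⟩`, the whole 3-plane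
`P = ℝω + Sg` (`Sg = ⟨Re σ, Im σ⟩`) is `⊥ e` — so `e` is of type `(1,1)` for EVERY complex structure of the twistor line
(period planes lie in `P ⊗ ℂ`): the line stays in the Nikulin locus and `heP` holds again at each
of its fibres. [folklore] -/
theorem threePlane_perp_of_invariant (B : V →ₗ[ℝ] V →ₗ[ℝ] ℝ) (P Sg : Submodule ℝ V) (ω : V)
    (hP : ∀ p ∈ P, ∃ a : ℝ, ∃ σ ∈ Sg, p = a • ω + σ)
    {e : V} (heS : ∀ σ ∈ Sg, B e σ = 0) (heω : B e ω = 0) : ∀ p ∈ P, B e p = 0 := by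
  intro p hp
  obtain ⟨a, σ, hσ, rfl⟩ := hP p hp
  simp [map_add, map_smul, heS σ hσ, heω]

/-- Non-vacuity of the pinning hypotheses in the smallest model: `V = W = ℝ × ℝ` with the standard
form, `P = P' = ⊤`, `T = id`, `s = id`; then every `e` with `s e = −e` is `0`, as the theorem says. -/
example : ∀ e : ℝ × ℝ, (LinearMap.id : ℝ × ℝ →ₗ[ℝ] ℝ × ℝ) e = -e → e = 0 := by
  intro e he
  simp only [LinearMap.id_apply] at he
  have h2 : (2 : ℝ) • e = 0 := by
    rw [two_smul]
    nth_rewrite 1 [he]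
    exact neg_add_cancel e
  exact (smul_eq_zero.mp h2).resolve_left two_ne_zero

end Summit.HodgeConjecture.HodgeConjecture.Theorems.NikulinSerreCarrier.Negative
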